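import Summits.HubbardSuperconductivity.HubbardSuperconductivity.Theses.FunctionFieldCertificate
import Summits.HubbardSuperconductivity.HubbardSuperconductivity.Theorems.FunctionFieldCertificateMesoscopicPairOrderStubLowestWeightCriterion
import Summits.HubbardSuperconductivity.HubbardSuperconductivity.Theorems.FunctionFieldCertificateMesoscopicPairOrderStubPairAdditionBound
import Summits.HubbardSuperconductivity.HubbardSuperconductivity.Theorems.FunctionFieldCertificateMesoscopicPairOrderStubCornerWindow
import HarnessLib

/-!
# Crux `MesoscopicPairOrder` (stmt-HubbardSuperconductivity-7331), line `SketchIdeator4`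
# (card `eta-lowest-weight-annihilators`) — the lead's skeleton (lead a1)

Route `FunctionFieldCertificate`, crux 2 (pole-free half): at one `(U, δ)`, a margin `m R²` for the
Fejér-box average `T_R(ψ)/L² = L⁻² Σ_{x,y} Πᵢ (1 - |(y - x)ᵢ|_L/R)₊ Re⟨P_x ψ, P_y ψ⟩` of the `d`-wave
pair correlation at arbitrarily large scales `R`, in EVERY normalised `(N_L, S^z = 0)`-sector ground
state of all large even tori (`P_x = localPair dWaveFormFactor L x`, `H_L = hubbardTorus 2 L 1 U`,
`N_L = 2⌊(1-δ)L²/2⌋`).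

The line (card `Cruxes/MesoscopicPairOrder/Ideas/eta-lowest-weight-annihilators.md`, sketch
`Cruxes/MesoscopicPairOrder/SketchIdeator4.lean`): Yang's `η = Σ_z (-1)^z c_{z↓}c_{z↑}`
(`etaLower torusStagger`) obeys `[H_L, η†] = U η†` on every even torus, so a cross-sector variational
comparison gives the LOWEST-WEIGHT CRITERION: if `E(2n+2, 0) < E(2n, 0) + U` then every ground state
of the sector `(2n+2, S^z = 0)` is annihilated by `η`. A density-weighted Euler ADDITION bound
`E(2n+2,0) ≤ E(2n,0) + (8n + U(2n+1))/(L² - n)` makes the criterion's hypothesis unconditional in the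
η-CORNER `δ ∈ (1/3, 1/2)`, `U > 8(1-δ)/(3δ-1)`. Hence in that corner every `(N_L, 0)` ground state is
η-annihilated, and the crux follows from its own body RESTRICTED to the corner and to η-annihilated
ground states (the load-bearing stub; the card claims no transfer — "the lever does not supply the
missing positivity" — and the lead expects the η hypothesis to be idle there).

Stubs (registered on the crux item by `ledger skeleton check`):
* `stub_lowestWeightCriterion` (S; PROVED in the sketch as `lowestWeightCriterion_holds`) — strict
  pair chemical potential below `U` ⇒ every sector ground state is `η`-annihilated — LANDED p124790, imported;
* `stub_pairAdditionBound` (M) — `E(2n+2,0) ≤ E(2n,0) + (8n + U(2n+1))/(L² - n)` for `U ≥ 0`,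
  `2n + 2 ≤ L²` (two one-electron additions averaged over all sites; mirror of the tree's
  `EnslavedA1g.minEnergyOn_pairRemoved_le`) — LANDED p125295, imported;
* `stub_cornerWindow` (M) — the addition bound (taken as a hypothesis, verbatim the signature of
  `stub_pairAdditionBound`) ⇒ for `δ ∈ (1/3,1/2)`, `U > 8(1-δ)/(3δ-1)` and all large `L`:
  `N_L/2 = n + 1 ≥ 1` and `E(N_L, 0) < E(N_L - 2, 0) + U` (real arithmetic with the floor) — LANDED
  p125420, imported;
* `stub_etaCornerOrder` (LOAD-BEARING, open) — the crux body at some `(U, δ)` of the η-corner for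
  normalised sector ground states `ψ` with `η ψ = 0`.

Composition `MesoscopicPairOrder_of : MesoscopicPairOrder` below. No definition is introduced.
Yang, PRL 63 (1989) 2144; Yang–Zhang, Mod. Phys. Lett. B 4 (1990) 759; Tasaki (2020) §2.1; folklore.
-/

noncomputable section

-- the summit namespace `Summit.HubbardSuperconductivity.HubbardSuperconductivity.…` repeats the problem name by design (D-0017)
set_option linter.dupNamespace false

namespace Summit.HubbardSuperconductivity.HubbardSuperconductivity.Theorems.FunctionFieldCertificate

open Matrix Finset Filter
open Literature.Probability.LatticeModels Literature.MathematicalPhysics.QuantumLattice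
open Summit.HubbardSuperconductivity.HubbardSuperconductivity.Theses.FunctionFieldCertificate
open scoped ComplexOrder

/-! ### Stubs 1–3 — LANDED (imported)

* `stub_lowestWeightCriterion` (strict pair chemical potential below `U` ⇒ every `(2n+2, 0)`-sector
  ground state is `η`-annihilated): p124790,
  `Theorems/FunctionFieldCertificateMesoscopicPairOrderStubLowestWeightCriterion.lean`;
* `stub_pairAdditionBound` (`E(2n+2,0) ≤ E(2n,0) + (8n + U(2n+1))/(L² - n)`, `U ≥ 0`): p125295,
  `Theorems/FunctionFieldCertificateMesoscopicPairOrderStubPairAdditionBound.lean`;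
* `stub_cornerWindow` (addition bound ⇒ strict window in the η-corner `δ ∈ (1/3,1/2)`,
  `U > 8(1-δ)/(3δ-1)`, all `L ≥ 2`): p125420,
  `Theorems/FunctionFieldCertificateMesoscopicPairOrderStubCornerWindow.lean`. -/

/-! ### Stub 4 — the crux body in the η-corner for η-annihilated ground states (load-bearing) -/

/-- **Stub `stub_etaCornerOrder`** (LOAD-BEARING; the open content of the line). At some `(U, δ)`
of the η-corner `δ ∈ (1/3, 1/2)`, `U > 8(1-δ)/(3δ-1)` there is `m > 0` such that for arbitrarily
large scales `R` and all large even `L`, every normalised `(N_L, S^z = 0)`-sector ground state `ψ`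
that is ANNIHILATED BY `η` (`etaLower torusStagger *ᵥ ψ = 0` — in the corner this is automatic by
stubs 1–3, so the hypothesis is expected to be idle: the stub is the crux restricted to the corner)
has Fejér-box `d`-wave pair order `m R² ≤ T_R(ψ)/L²` (the crux body verbatim). OPEN (it contains
`d`-wave pair order of the overdoped, strong-coupling pure 2D Hubbard model in every sector ground
state). -/
theorem stub_etaCornerOrder : ∃ U : ℝ, 0 < U ∧ ∃ δ ∈ Set.Ioo (1 / 3 : ℝ) (1 / 2),
    8 * (1 - δ) / (3 * δ - 1) < U ∧
    ∃ m : ℝ, 0 < m ∧ ∀ R₀ : ℕ, ∃ R : ℕ, R₀ ≤ R ∧ ∃ L₀ : ℕ, ∀ (L : ℕ) [NeZero L], L₀ ≤ L → Even L →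
      ∀ ψ : Fock (Orb (FermionTorus 2 L)), star ψ ⬝ᵥ ψ = 1 →
        IsGroundStateInSector (hubbardTorus 2 L 1 U) (2 * ⌊(1 - δ) * (L : ℝ) ^ 2 / 2⌋₊) 0 ψ →
          etaLower (torusStagger : FermionTorus 2 L → ℤˣ) *ᵥ ψ = 0 →
            m * (R : ℝ) ^ 2 ≤ (∑ x : TorusSite 2 L, ∑ y : TorusSite 2 L,
              (∏ i : Fin 2, max 0 (1 - |(((y i - x i).valMinAbs : ℤ) : ℝ)| / (R : ℝ))) *
                (star (localPair dWaveFormFactor L x *ᵥ ψ) ⬝ᵥ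
                  (localPair dWaveFormFactor L y *ᵥ ψ)).re) / (L : ℝ) ^ 2 := by
  sorry

/-! ### Composition -/

/-- **The line closes the crux modulo its stubs**: at the `(U, δ, m, R)` of `stub_etaCornerOrder`
and for `L` beyond both thresholds, `stub_cornerWindow` (fed with `stub_pairAdditionBound`) writes
`N_L = 2(n+1)` with `E(N_L, 0) < E(N_L - 2, 0) + U`, `stub_lowestWeightCriterion` gives `η ψ = 0` for
every `(N_L, 0)`-sector ground state `ψ`, and the load-bearing stub gives the body; the corner
`(1/3, 1/2) ⊂ (0, 1/2)`. [folklore] -/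
theorem MesoscopicPairOrder_of : MesoscopicPairOrder := by
  obtain ⟨U, hU, δ, hδ, hUδ, m, hm, hall⟩ := stub_etaCornerOrder
  obtain ⟨L₁, hL₁⟩ := stub_cornerWindow stub_pairAdditionBound U δ hδ hUδ
  refine ⟨U, hU, δ, ⟨by linarith [hδ.1], hδ.2⟩, m, hm, fun R₀ => ?_⟩
  obtain ⟨R, hR₀, L₀, hL⟩ := hall R₀
  refine ⟨R, hR₀, max L₀ L₁, ?_⟩
  intro L _ hLge hE ψ hψ hgs
  obtain ⟨n, hn, h2n, hstrict⟩ := hL₁ L (le_of_max_le_right hLge)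
  have hgs' : IsGroundStateInSector (hubbardTorus 2 L 1 U) (2 * (n + 1)) 0 ψ := by
    rw [← hn]; exact hgs
  have heta := stub_lowestWeightCriterion U L hE n h2n hstrict ψ hgs'
  exact hL L (le_of_max_le_left hLge) hE ψ hψ hgs heta

end Summit.HubbardSuperconductivity.HubbardSuperconductivity.Theorems.FunctionFieldCertificate
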